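import Summits.AnomalousDissipation.AnomalousDissipation.Theorems.SawtoothPulseCascadeK1LocalisedCascadeFlatCurvatureCascade
import Summits.AnomalousDissipation.AnomalousDissipation.Theorems.SawtoothPulseCascadeK1LocalisedCascadeAffineProfileCascade

/-!
# K1loc, line `Spectral` / SeqCone — helper: THE RESIDUAL SHEAR `U_j − Ũ_j` (profile data for the tiny-shear leakage step)

Helper file of the prover lane on the crux `K1LocalisedCascade` (stmt-AnomalousDissipation-19491), route
`SawtoothPulseCascade` (glue seat k1loc-p3; socket (a) of ad-k1loc-p2's A4, cascade part).  With the mean-zero slope correction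
`D = D_δ(U_j′)` of `…AffineProfileCascade` (width `δ`), the affine-ized profile is `Ũ_j = U_j + R`, `R(y) = ∫₀ʸ D`, so the
shear by `γU_j` factors as the exact-flat shear by `γŨ_j` composed with the RESIDUAL shear by `−γR`.  `…TwistMoments` turns sup
bounds `|Q′| ≤ D₁`, `|Q″| ≤ D₂` of the residual profile into the leakage constant `A_res(n)`; this file supplies them for `R`:
* `hasDerivAt_residual`, `deriv_residual`, `periodic_residual`, `contDiff_residual`, `abs_residual_le` — `R′ = D(U_j′)`,
  `R` is `1`-periodic (mean zero), smooth, `|R| ≤ 2δ`;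
* `abs_deriv_residual_le` — `|R′| ≤ 2δ`;
* `hasDerivAt_slopeCorr_comp` / `abs_deriv_slopeCorr_comp_le` — `(D(U_j′))′ = −U_j″(G⁺ + G⁻) + (1 − U_j′)G⁺′ + (−1 − U_j′)G⁻′`
  and, by the flat-curvature layer bounds (`…FlatCurvatureCascade`) and the `ε`-free cut-off bounds,
  `|R″| = |(D(U_j′))′| ≤ (2 + 8C₁)(M + 4)(2πN_j/δ_j)·δ` whenever `e^{−M²/2} ≤ 2δ`, `M ≥ 1`, `0 < δ ≤ 1/2`
  (`abs_deriv_deriv_residual_le`).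
Hence `D₁ = 2γδ`, `D₂ = γ(2 + 8C₁)(M + 4)(2πN_j/δ_j)δ` for `Q = ±γR`: the residual leakage `A_res(n) ≲ ω₁|n|γ(N_j/δ_j)Mδ`
is as small as the affine-ization width `δ` (chosen per phase).  No definitions; no statement about the stub.
[cite: ElgindiLissMattingly2025, §1 (the piecewise-linear shears H_α, V_α)] [problem: turb]
-/

-- `Summit.<Summit>.<Problem>`: single-conjunct summit, the duplicate namespace segment is deliberate.
set_option linter.dupNamespace false

noncomputable section

namespace Summit.AnomalousDissipation.AnomalousDissipation.Theorems.SawtoothPulseCascade.K1Cutoff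

open Set Filter Topology Real MeasureTheory intervalIntegral
open scoped ContDiff
open Literature.Analysis.FluidPDE.SawtoothCascade Literature.Analysis.FluidPDE.SawtoothCascade.CascadeParams
open Literature.Analysis.Calculus (differentiable_smoothTransition)
open Summit.AnomalousDissipation.AnomalousDissipation.Theorems.SawtoothPulseCascade.K1Flat

variable (P : CascadeParams)

/-! ## The residual profile `R = ∫₀ D(U_j′)` -/

/-- `R′(y) = D(U_j′(y))` (`δ_j > 0`). [cite: ElgindiLissMattingly2025, §1 (H_α, V_α)] -/
theorem hasDerivAt_residual {j : ℕ} (hδj : 0 < P.δ j) (δ y : ℝ) :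
    HasDerivAt (fun y => ∫ t in (0 : ℝ)..y, ((1 - deriv (P.U j) t) * smoothTransition ((deriv (P.U j) t - (1 - 2 * δ)) / δ) +
        (-1 - deriv (P.U j) t) * smoothTransition ((-deriv (P.U j) t - (1 - 2 * δ)) / δ)))
      ((1 - deriv (P.U j) y) * smoothTransition ((deriv (P.U j) y - (1 - 2 * δ)) / δ) +
        (-1 - deriv (P.U j) y) * smoothTransition ((-deriv (P.U j) y - (1 - 2 * δ)) / δ)) y :=
  ((contDiff_slopeCorr (P.contDiff_deriv_U hδj) δ).continuous.integral_hasStrictDerivAt 0 y).hasDerivAt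

/-- `R′ = D(U_j′)` as functions. [cite: ElgindiLissMattingly2025, §1 (H_α, V_α)] -/
theorem deriv_residual {j : ℕ} (hδj : 0 < P.δ j) (δ : ℝ) :
    deriv (fun y => ∫ t in (0 : ℝ)..y, ((1 - deriv (P.U j) t) * smoothTransition ((deriv (P.U j) t - (1 - 2 * δ)) / δ) +
        (-1 - deriv (P.U j) t) * smoothTransition ((-deriv (P.U j) t - (1 - 2 * δ)) / δ))) =
      fun y => (1 - deriv (P.U j) y) * smoothTransition ((deriv (P.U j) y - (1 - 2 * δ)) / δ) +
        (-1 - deriv (P.U j) y) * smoothTransition ((-deriv (P.U j) y - (1 - 2 * δ)) / δ) :=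
  funext fun y => (hasDerivAt_residual P hδj δ y).deriv

/-- `R` is `1`-periodic (its integrand has mean zero over a period; `N_j ≠ 0`). [cite: ElgindiLissMattingly2025, §1 (H_α, V_α)] -/
theorem periodic_residual {j : ℕ} (hδj : 0 < P.δ j) (hN : P.N j ≠ 0) (δ : ℝ) :
    Function.Periodic (fun y => ∫ t in (0 : ℝ)..y, ((1 - deriv (P.U j) t) * smoothTransition ((deriv (P.U j) t - (1 - 2 * δ)) / δ) +
        (-1 - deriv (P.U j) t) * smoothTransition ((-deriv (P.U j) t - (1 - 2 * δ)) / δ))) 1 := by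
  intro y
  have h := periodic_affinizeU P hδj hN δ y
  have hU := P.U_periodic j y
  simp only at h
  linarith

/-- `R` is smooth. [cite: ElgindiLissMattingly2025, §1 (H_α, V_α)] -/
theorem contDiff_residual {j : ℕ} (hδj : 0 < P.δ j) (δ : ℝ) :
    ContDiff ℝ ∞ (fun y => ∫ t in (0 : ℝ)..y, ((1 - deriv (P.U j) t) * smoothTransition ((deriv (P.U j) t - (1 - 2 * δ)) / δ) +
        (-1 - deriv (P.U j) t) * smoothTransition ((-deriv (P.U j) t - (1 - 2 * δ)) / δ))) := by
  refine contDiff_infty_iff_deriv.mpr ⟨fun y => (hasDerivAt_residual P hδj δ y).differentiableAt, ?_⟩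
  rw [deriv_residual P hδj δ]
  exact contDiff_slopeCorr (P.contDiff_deriv_U hδj) δ

/-- `|R| ≤ 2δ` everywhere (`0 < δ ≤ 1/2`, `N_j ≠ 0`). [cite: ElgindiLissMattingly2025, §1 (H_α, V_α)] -/
theorem abs_residual_le {δ : ℝ} (hδ : 0 < δ) (hδ2 : δ ≤ 1 / 2) {j : ℕ} (hδj : 0 < P.δ j) (hN : P.N j ≠ 0) (y : ℝ) :
    |∫ t in (0 : ℝ)..y, ((1 - deriv (P.U j) t) * smoothTransition ((deriv (P.U j) t - (1 - 2 * δ)) / δ) +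
        (-1 - deriv (P.U j) t) * smoothTransition ((-deriv (P.U j) t - (1 - 2 * δ)) / δ))| ≤ 2 * δ :=
  abs_intervalIntegral_le_of_mean_zero (periodic_slopeCorr (P.deriv_U_periodic j) δ)
    (contDiff_slopeCorr (P.contDiff_deriv_U hδj) δ).continuous (integral_slopeCorr_deriv_U_eq_zero P hN δ)
    (fun t => abs_slopeCorr_le hδ hδ2 (fun y => P.abs_deriv_U_le_one hδj y) t) y

/-- **`|R′| ≤ 2δ`** (`0 < δ ≤ 1/2`). [cite: ElgindiLissMattingly2025, §1 (H_α, V_α have slope ±1)] -/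
theorem abs_deriv_residual_le {δ : ℝ} (hδ : 0 < δ) (hδ2 : δ ≤ 1 / 2) {j : ℕ} (hδj : 0 < P.δ j) (y : ℝ) :
    |deriv (fun y => ∫ t in (0 : ℝ)..y, ((1 - deriv (P.U j) t) * smoothTransition ((deriv (P.U j) t - (1 - 2 * δ)) / δ) +
        (-1 - deriv (P.U j) t) * smoothTransition ((-deriv (P.U j) t - (1 - 2 * δ)) / δ))) y| ≤ 2 * δ := by
  rw [congrFun (deriv_residual P hδj δ) y]
  exact abs_slopeCorr_le hδ hδ2 (fun y => P.abs_deriv_U_le_one hδj y) y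

/-! ## The derivative of the slope correction along the profile: `(D(U_j′))′` -/

/-- **Chain/product rule for `D(U_j′)`**: with `V = U_j′`, `G^± = sT((±V − (1−2δ))/δ)`,
`(D(V))′ = −V′(G⁺ + G⁻) + (1 − V)G⁺′ + (−1 − V)G⁻′`. [folklore] -/
theorem hasDerivAt_slopeCorr_comp {j : ℕ} (hδj : 0 < P.δ j) (hN : P.N j ≠ 0) (δ y : ℝ) :
    HasDerivAt (fun y => (1 - deriv (P.U j) y) * smoothTransition ((deriv (P.U j) y - (1 - 2 * δ)) / δ) +
        (-1 - deriv (P.U j) y) * smoothTransition ((-deriv (P.U j) y - (1 - 2 * δ)) / δ))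
      (-deriv (deriv (P.U j)) y * smoothTransition ((deriv (P.U j) y - (1 - 2 * δ)) / δ) +
          (1 - deriv (P.U j) y) * deriv (fun y => smoothTransition ((deriv (P.U j) y - (1 - 2 * δ)) / δ)) y +
        (-deriv (deriv (P.U j)) y * smoothTransition ((-deriv (P.U j) y - (1 - 2 * δ)) / δ) +
          (-1 - deriv (P.U j) y) * deriv (fun y => smoothTransition ((-deriv (P.U j) y - (1 - 2 * δ)) / δ)) y)) y := by
  have hV : HasDerivAt (deriv (P.U j)) (deriv (deriv (P.U j)) y) y := (P.hasDerivAt_deriv_U hδj hN y).differentiableAt.hasDerivAt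
  have hVd : Differentiable ℝ (deriv (P.U j)) := (P.contDiff_deriv_U hδj (n := 1)).differentiable (by simp)
  have hGp : HasDerivAt (fun y => smoothTransition ((deriv (P.U j) y - (1 - 2 * δ)) / δ))
      (deriv (fun y => smoothTransition ((deriv (P.U j) y - (1 - 2 * δ)) / δ)) y) y :=
    (hasDerivAt_cutoff (hVd y).hasDerivAt).differentiableAt.hasDerivAt
  have hGm : HasDerivAt (fun y => smoothTransition ((-deriv (P.U j) y - (1 - 2 * δ)) / δ))
      (deriv (fun y => smoothTransition ((-deriv (P.U j) y - (1 - 2 * δ)) / δ)) y) y :=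
    (hasDerivAt_cutoff (V := fun y => -deriv (P.U j) y) (hVd y).hasDerivAt.neg).differentiableAt.hasDerivAt
  have h1 : HasDerivAt (fun y => 1 - deriv (P.U j) y) (-deriv (deriv (P.U j)) y) y := hV.const_sub 1
  have h2 : HasDerivAt (fun y => -1 - deriv (P.U j) y) (-deriv (deriv (P.U j)) y) y := hV.const_sub (-1)
  exact (h1.mul hGp).add (h2.mul hGm)

/-- **The derivative of the slope correction is `O(δ)`**: for `0 < δ ≤ 1/2`, `M ≥ 1` with `e^{−M²/2} ≤ 2δ` and `C₁` a bound
of `|sT′|`: `|(D(U_j′))′(y)| ≤ (2 + 8C₁)(M + 4)(2πN_j/δ_j)·δ` for every `y` — where a cut-off or its derivative is non-zero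
the slope is within `2δ` of `±1`, so `|U_j″| ≤ (M+4)(2πN_j/δ_j)·2δ` (flat curvature) and `|G^±′| ≤ 2C₁(M+4)(2πN_j/δ_j)`
(`ε`-free cut-off bound) while `|1 ∓ U_j′| ≤ 2δ`. [cite: ElgindiLissMattingly2025, §1 and Rmk. 1.4 (the smoothed pulse profiles)] -/
theorem abs_deriv_slopeCorr_comp_le {δ M C₁ : ℝ} (hδ : 0 < δ) (hδ2 : δ ≤ 1 / 2) (hM : 1 ≤ M)
    (hMδ : Real.exp (-(M ^ 2 / 2)) ≤ 2 * δ) (hC₁ : ∀ x, |deriv smoothTransition x| ≤ C₁) {j : ℕ} (hδj : 0 < P.δ j)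
    (hN : P.N j ≠ 0) (y : ℝ) :
    |deriv (fun y => (1 - deriv (P.U j) y) * smoothTransition ((deriv (P.U j) y - (1 - 2 * δ)) / δ) +
        (-1 - deriv (P.U j) y) * smoothTransition ((-deriv (P.U j) y - (1 - 2 * δ)) / δ)) y| ≤
      (2 + 8 * C₁) * (M + 4) * (2 * Real.pi * P.N j / P.δ j) * δ := by
  have hC₁0 : 0 ≤ C₁ := (abs_nonneg _).trans (hC₁ 0)
  have hM4 : 0 ≤ M + 4 := by linarith
  set Λ : ℝ := 2 * Real.pi * P.N j / P.δ j with hΛ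
  have hΛ0 : 0 ≤ Λ := by positivity
  set V : ℝ → ℝ := deriv (P.U j) with hVdef
  have hVd : Differentiable ℝ V := (P.contDiff_deriv_U hδj (n := 1)).differentiable (by simp)
  rw [(hasDerivAt_slopeCorr_comp P hδj hN δ y).deriv]
  -- the four ingredients
  have hGp0 := cutoff_nonneg V δ y
  have hGm0 := cutoff_nonneg (fun y => -V y) δ y
  have hGp1 := cutoff_le_one V δ y
  have hGm1 := cutoff_le_one (fun y => -V y) δ y
  have hdis := cutoff_mul_cutoff_neg_eq_zero (V := V) hδ hδ2 y
  -- `|U″·G^±| ≤ (M+4)Λ(2δ)·G^±`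
  have hcurv_p : |deriv V y| * smoothTransition ((V y - (1 - 2 * δ)) / δ) ≤
      (M + 4) * Λ * (2 * δ) * smoothTransition ((V y - (1 - 2 * δ)) / δ) := by
    by_cases h0 : smoothTransition ((V y - (1 - 2 * δ)) / δ) = 0
    · rw [h0, mul_zero, mul_zero]
    · have hlt := lt_of_cutoff_ne_zero hδ h0
      exact mul_le_mul_of_nonneg_right
        (abs_deriv2_U_le_of_layer P hδj hM hMδ (s₀ := 1) (Or.inl rfl) (by rw [one_mul]; linarith)) hGp0
  have hcurv_m : |deriv V y| * smoothTransition ((-V y - (1 - 2 * δ)) / δ) ≤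
      (M + 4) * Λ * (2 * δ) * smoothTransition ((-V y - (1 - 2 * δ)) / δ) := by
    by_cases h0 : smoothTransition ((-V y - (1 - 2 * δ)) / δ) = 0
    · rw [h0, mul_zero, mul_zero]
    · have hlt := lt_of_cutoff_ne_zero (V := fun y => -V y) hδ h0
      exact mul_le_mul_of_nonneg_right
        (abs_deriv2_U_le_of_layer P hδj hM hMδ (s₀ := -1) (Or.inr rfl) (by linarith)) hGm0
  -- `|(1−V)·G⁺′| ≤ 2δ·2C₁(M+4)Λ` and the same for the `−` family
  have hlay_p : |(1 - V y) * deriv (fun y => smoothTransition ((V y - (1 - 2 * δ)) / δ)) y| ≤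
      2 * δ * (2 * C₁ * (M + 4) * Λ) := by
    by_cases h0 : deriv (fun y => smoothTransition ((V y - (1 - 2 * δ)) / δ)) y = 0
    · rw [h0, mul_zero, abs_zero]; positivity
    · obtain ⟨h1, h2⟩ := mem_Ioo_of_deriv_cutoff_ne_zero hδ hVd h0
      rw [abs_mul]
      refine mul_le_mul (by rw [abs_le]; constructor <;> linarith) ?_ (abs_nonneg _) (by positivity)
      exact abs_deriv_cutoff_deriv_U_le_of_layer P hδj hδ hM hMδ hC₁ y
  have hlay_m : |(-1 - V y) * deriv (fun y => smoothTransition ((-V y - (1 - 2 * δ)) / δ)) y| ≤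
      2 * δ * (2 * C₁ * (M + 4) * Λ) := by
    by_cases h0 : deriv (fun y => smoothTransition ((-V y - (1 - 2 * δ)) / δ)) y = 0
    · rw [h0, mul_zero, abs_zero]; positivity
    · obtain ⟨h1, h2⟩ := mem_Ioo_of_deriv_cutoff_ne_zero (V := fun y => -V y) hδ hVd.neg h0
      rw [abs_mul]
      refine mul_le_mul (by rw [abs_le]; constructor <;> linarith) ?_ (abs_nonneg _) (by positivity)
      exact abs_deriv_cutoff_neg_deriv_U_le_of_layer P hδj hδ hM hMδ hC₁ y
  -- `G⁺ + G⁻ ≤ 1`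
  have hsum : smoothTransition ((V y - (1 - 2 * δ)) / δ) + smoothTransition ((-V y - (1 - 2 * δ)) / δ) ≤ 1 := by
    rcases mul_eq_zero.mp hdis with h | h
    · rw [h, zero_add]; exact hGm1
    · rw [h, add_zero]; exact hGp1
  -- assemble
  have hA : |-deriv V y * smoothTransition ((V y - (1 - 2 * δ)) / δ) +
      -deriv V y * smoothTransition ((-V y - (1 - 2 * δ)) / δ)| ≤ (M + 4) * Λ * (2 * δ) := by
    rw [← mul_add, abs_mul, abs_neg]
    calc |deriv V y| * |smoothTransition ((V y - (1 - 2 * δ)) / δ) + smoothTransition ((-V y - (1 - 2 * δ)) / δ)|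
        = |deriv V y| * smoothTransition ((V y - (1 - 2 * δ)) / δ) +
            |deriv V y| * smoothTransition ((-V y - (1 - 2 * δ)) / δ) := by
          rw [abs_of_nonneg (add_nonneg hGp0 hGm0), mul_add]
      _ ≤ (M + 4) * Λ * (2 * δ) * smoothTransition ((V y - (1 - 2 * δ)) / δ) +
            (M + 4) * Λ * (2 * δ) * smoothTransition ((-V y - (1 - 2 * δ)) / δ) := add_le_add hcurv_p hcurv_m
      _ = (M + 4) * Λ * (2 * δ) * (smoothTransition ((V y - (1 - 2 * δ)) / δ) +
            smoothTransition ((-V y - (1 - 2 * δ)) / δ)) := by ring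
      _ ≤ (M + 4) * Λ * (2 * δ) * 1 := mul_le_mul_of_nonneg_left hsum (by positivity)
      _ = (M + 4) * Λ * (2 * δ) := mul_one _
  calc |-deriv V y * smoothTransition ((V y - (1 - 2 * δ)) / δ) +
          (1 - V y) * deriv (fun y => smoothTransition ((V y - (1 - 2 * δ)) / δ)) y +
        (-deriv V y * smoothTransition ((-V y - (1 - 2 * δ)) / δ) +
          (-1 - V y) * deriv (fun y => smoothTransition ((-V y - (1 - 2 * δ)) / δ)) y)|
      = |(-deriv V y * smoothTransition ((V y - (1 - 2 * δ)) / δ) +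
          -deriv V y * smoothTransition ((-V y - (1 - 2 * δ)) / δ)) +
          ((1 - V y) * deriv (fun y => smoothTransition ((V y - (1 - 2 * δ)) / δ)) y +
          (-1 - V y) * deriv (fun y => smoothTransition ((-V y - (1 - 2 * δ)) / δ)) y)| := by ring_nf
    _ ≤ (M + 4) * Λ * (2 * δ) + (2 * δ * (2 * C₁ * (M + 4) * Λ) + 2 * δ * (2 * C₁ * (M + 4) * Λ)) :=
        (abs_add_le _ _).trans (add_le_add hA ((abs_add_le _ _).trans (add_le_add hlay_p hlay_m)))
    _ = (2 + 8 * C₁) * (M + 4) * Λ * δ := by ring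

/-- **`|R″| ≤ (2 + 8C₁)(M + 4)(2πN_j/δ_j)·δ`** (`0 < δ ≤ 1/2`, `M ≥ 1`, `e^{−M²/2} ≤ 2δ`): the `D₂` of `…TwistMoments` for
the residual shear, small with the affine-ization width `δ`. [cite: ElgindiLissMattingly2025, §1 and Rmk. 1.4 (the smoothed pulse profiles)] -/
theorem abs_deriv_deriv_residual_le {δ M C₁ : ℝ} (hδ : 0 < δ) (hδ2 : δ ≤ 1 / 2) (hM : 1 ≤ M)
    (hMδ : Real.exp (-(M ^ 2 / 2)) ≤ 2 * δ) (hC₁ : ∀ x, |deriv smoothTransition x| ≤ C₁) {j : ℕ} (hδj : 0 < P.δ j)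
    (hN : P.N j ≠ 0) (y : ℝ) :
    |deriv (deriv fun y => ∫ t in (0 : ℝ)..y, ((1 - deriv (P.U j) t) * smoothTransition ((deriv (P.U j) t - (1 - 2 * δ)) / δ) +
        (-1 - deriv (P.U j) t) * smoothTransition ((-deriv (P.U j) t - (1 - 2 * δ)) / δ))) y| ≤
      (2 + 8 * C₁) * (M + 4) * (2 * Real.pi * P.N j / P.δ j) * δ := by
  rw [deriv_residual P hδj δ]
  exact abs_deriv_slopeCorr_comp_le P hδ hδ2 hM hMδ hC₁ hδj hN y


/-! ## The scaled residual profile `Q = c·R` (`c = ±γ`) -/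

/-- **`|Q′| ≤ |c|·2δ`** for `Q = c·R` (`0 < δ ≤ 1/2`): the `D₁` of `…TwistMoments` for the residual shear `γ(U_j − Ũ_j) = −γR`.
[cite: ElgindiLissMattingly2025, §1 (H_α, V_α have slope ±1)] -/
theorem abs_deriv_const_mul_residual_le (c : ℝ) {δ : ℝ} (hδ : 0 < δ) (hδ2 : δ ≤ 1 / 2) {j : ℕ} (hδj : 0 < P.δ j) (y : ℝ) :
    |deriv (fun y => c * ∫ t in (0 : ℝ)..y, ((1 - deriv (P.U j) t) * smoothTransition ((deriv (P.U j) t - (1 - 2 * δ)) / δ) +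
        (-1 - deriv (P.U j) t) * smoothTransition ((-deriv (P.U j) t - (1 - 2 * δ)) / δ))) y| ≤ |c| * (2 * δ) := by
  rw [((hasDerivAt_residual P hδj δ y).const_mul c).deriv, abs_mul]
  exact mul_le_mul_of_nonneg_left (abs_slopeCorr_le hδ hδ2 (fun y => P.abs_deriv_U_le_one hδj y) y) (abs_nonneg c)

/-- **`|Q″| ≤ |c|(2 + 8C₁)(M + 4)(2πN_j/δ_j)·δ`** for `Q = c·R` (`0 < δ ≤ 1/2`, `M ≥ 1`, `e^{−M²/2} ≤ 2δ`): the `D₂` of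
`…TwistMoments` for the residual shear. [cite: ElgindiLissMattingly2025, §1 and Rmk. 1.4 (the smoothed pulse profiles)] -/
theorem abs_deriv_deriv_const_mul_residual_le (c : ℝ) {δ M C₁ : ℝ} (hδ : 0 < δ) (hδ2 : δ ≤ 1 / 2) (hM : 1 ≤ M)
    (hMδ : Real.exp (-(M ^ 2 / 2)) ≤ 2 * δ) (hC₁ : ∀ x, |deriv smoothTransition x| ≤ C₁) {j : ℕ} (hδj : 0 < P.δ j)
    (hN : P.N j ≠ 0) (y : ℝ) :
    |deriv (deriv fun y => c * ∫ t in (0 : ℝ)..y, ((1 - deriv (P.U j) t) * smoothTransition ((deriv (P.U j) t - (1 - 2 * δ)) / δ) +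
        (-1 - deriv (P.U j) t) * smoothTransition ((-deriv (P.U j) t - (1 - 2 * δ)) / δ))) y| ≤
      |c| * ((2 + 8 * C₁) * (M + 4) * (2 * Real.pi * P.N j / P.δ j) * δ) := by
  have hd1 : deriv (fun y => c * ∫ t in (0 : ℝ)..y, ((1 - deriv (P.U j) t) *
      smoothTransition ((deriv (P.U j) t - (1 - 2 * δ)) / δ) +
        (-1 - deriv (P.U j) t) * smoothTransition ((-deriv (P.U j) t - (1 - 2 * δ)) / δ))) =
      fun y => c * ((1 - deriv (P.U j) y) * smoothTransition ((deriv (P.U j) y - (1 - 2 * δ)) / δ) +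
        (-1 - deriv (P.U j) y) * smoothTransition ((-deriv (P.U j) y - (1 - 2 * δ)) / δ)) :=
    funext fun y => ((hasDerivAt_residual P hδj δ y).const_mul c).deriv
  rw [hd1, ((hasDerivAt_slopeCorr_comp P hδj hN δ y).const_mul c).deriv, abs_mul,
    ← (hasDerivAt_slopeCorr_comp P hδj hN δ y).deriv]
  exact mul_le_mul_of_nonneg_left (abs_deriv_slopeCorr_comp_le P hδ hδ2 hM hMδ hC₁ hδj hN y) (abs_nonneg c)

end Summit.AnomalousDissipation.AnomalousDissipation.Theorems.SawtoothPulseCascade.K1Cutoff
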